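import Literature.Barriers.Parity.SiegelZeroDichotomyPairHLSiegelModel
import Mathlib.Analysis.Calculus.BumpFunction.Normed
import HarnessLib

/-!
# Tao–Teräväinen 2022, §7: the Type I approximant `Λ♯_Siegel` and the error `Λ♭_Siegel` (`k = 2`)

Topic `Literature/Barriers/Parity`, sub-namespace `TaoTeravainen`; the definitions file of step
(iv) of the proof DAG of `Literature.Barriers.Parity.TaoTeravainen2021_prop72_81_pair` (T. Tao,
J. Teräväinen, *The Hardy–Littlewood–Chowla conjecture in the presence of a Siegel zero*, J. London
Math. Soc. (2) 106 (2022), arXiv:2109.06291, §7 "Fourth step: replacing the von Mangoldt Siegel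
model with a Type I approximant"). Everything here is PROVED.

The source: "Let `φ : ℝ → ℝ` be a smooth even function supported on `[-1,1]` of total mass one.
For any `t > 0`, define `Φ_t(n) := φ(log(n/t))` … (7.1) `χ∗log(n) = ∫₀^∞ χ∗Φ_t(n) log t dt/t`.
… we split `χ∗log = (χ∗log)♯ + (χ∗log)♭` … (7.3)
`(χ∗log)♭(n) := ∫_{Dq_χ²}^∞ ψ_{>(Dq_χ²)²}(x/t) χ∗(Φ_t - Φ_{Dq_χ²})(n) log t dt/t` …
`Λ♯_Siegel := (χ∗log)♯ ν`, `Λ♭_Siegel := (χ∗log)♭ ν`."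

We work in the variable `u = log t` throughout (`X = log x`, `U₀ = log(Dq_χ²)`):

* `IsBump φ`, `stdBump` (a fixed admissible `φ`, Mathlib's normalised bump) and the integrals
  `∫ φ(c - u) du = 1`, `∫ φ(c - u) u du = c` (`IsBump.integral_sub_left_mul`);
* `hypK χ φ u n = K_u(n) := ∑_{ab = n} χ(a) φ(log b - u)` (`= χ∗Φ_{e^u}(n)`), its support in `u`
  and the bound `|K_u(n)| ≤ ‖φ‖_∞ τ(n)`; **(7.1)** `charLog_eq_integral_hypK`:
  `χ∗log(n) = ∫ K_u(n) u du`;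
* `flatWeight ψ X U₀ u = ρ(u) := 1_{u ≤ X} (1 - ψ((X-u)/(2U₀)))` (the weight
  `ψ_{>(Dq_χ²)²}(x/t)`, extended by `0` for `t > x` where the source's integrand is meant to
  vanish), `flatLog χ φ ψ X U₀ n = (χ∗log)♭(n) := ∫_{U₀}^{X-U₀} ρ(u) u K_u(n) du - (∫_{U₀}^{X} ρ(u) u du) K_{U₀}(n)`
  ((7.3) in the variable `u`), `sharpLog := charLog - flatLog` ((7.2)),
  `vonMangoldtSiegelFlat/Sharp := flatLog/sharpLog · ν` with `Λ_Siegel = Λ♯ + Λ♭`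
  (`vonMangoldtSiegel_eq_sharp_add_flat`);
* `hypKD` (`K̃_u(n) = ∑ χ(a) φ'(log b - u) = χ∗Φ̃_{e^u}(n)`), the derivative
  `∂_u K_u(n) = -K̃_u(n)`, and **the integrated-by-parts form**
  `flatLog_eq_neg_integral`: `(χ∗log)♭(n) = -∫_{U₀}^{X-U₀} P(v) K̃_v(n) dv`,
  `P(v) = ∫_v^X ρ(u) u du` ("By the fundamental theorem of calculus one has
  `Φ_t(n) - Φ_{Dq_χ²}(n) = -∫ Φ̃_{t'}(n) dt'/t'`"), with `0 ≤ P ≤ X²`;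
* crude bounds `|K̃_u(n)| ≤ ‖φ'‖_∞ τ(n)`, `|(χ∗log)♭(n)| ≤ C X² τ(n)`.
  [cite: TaoTeravainen2021, §7 (7.1)–(7.3) and the first steps of the proof of Proposition 7.1]
-/

noncomputable section

open Finset MeasureTheory Real intervalIntegral
open scoped ContDiff Topology

namespace Literature.Barriers.Parity

namespace TaoTeravainen

/-! ### The bump `φ` -/

/-- An admissible `φ`: smooth, supported in `[-1,1]`, total mass one, even, non-negative.
[cite: TaoTeravainen2021, §7 ("Let `φ : ℝ → ℝ` be a smooth even function supported on `[-1,1]`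
of total mass one")] -/
structure IsBump (φ : ℝ → ℝ) : Prop where
  contDiff : ContDiff ℝ ∞ φ
  eq_zero : ∀ u : ℝ, 1 ≤ |u| → φ u = 0
  integral_eq : ∫ u, φ u = 1
  even : ∀ u : ℝ, φ (-u) = φ u
  nonneg : ∀ u : ℝ, 0 ≤ φ u

/-- A fixed admissible `φ`: Mathlib's normalised bump with radii `1/2, 1`. [folklore] -/
def stdBumpData : ContDiffBump (0 : ℝ) := ⟨1 / 2, 1, by norm_num, by norm_num⟩

/-- The fixed `φ`. [cite: TaoTeravainen2021, §7] -/
def stdBump : ℝ → ℝ := stdBumpData.normed volume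

/-- `stdBump` is admissible. [folklore] -/
theorem isBump_stdBump : IsBump stdBump where
  contDiff := stdBumpData.contDiff_normed
  eq_zero u hu := by
    have h : u ∉ Function.support (stdBumpData.normed volume) := by
      rw [stdBumpData.support_normed_eq, Metric.mem_ball, Real.dist_eq, sub_zero, not_lt]
      exact hu
    simpa [stdBump, Function.mem_support] using h
  integral_eq := stdBumpData.integral_normed
  even u := stdBumpData.normed_neg u
  nonneg u := by
    rw [stdBump, ContDiffBump.normed_def]
    exact div_nonneg stdBumpData.nonneg stdBumpData.integral_pos.le

namespace IsBump

variable {φ : ℝ → ℝ} (hφ : IsBump φ)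
include hφ

/-- `φ` is continuous. [folklore] -/
theorem continuous : Continuous φ := hφ.contDiff.continuous

/-- `φ` vanishes outside `[-1, 1]`. [folklore] -/
theorem eq_zero_of_notMem {u : ℝ} (hu : u ∉ Set.Icc (-1 : ℝ) 1) : φ u = 0 := by
  refine hφ.eq_zero u ?_
  rw [Set.mem_Icc, not_and_or, not_le, not_le] at hu
  rcases hu with h | h
  · rw [abs_of_neg (by linarith)]; linarith
  · rw [abs_of_pos (by linarith)]; linarith

/-- `φ` has compact support. [folklore] -/
theorem hasCompactSupport : HasCompactSupport φ :=
  HasCompactSupport.of_support_subset_isCompact isCompact_Icc fun u hu => by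
    by_contra h
    exact hu (hφ.eq_zero_of_notMem h)

/-- `φ` is integrable. [folklore] -/
theorem integrable : Integrable φ := hφ.continuous.integrable_of_hasCompactSupport hφ.hasCompactSupport

/-- `φ` is bounded. [folklore] -/
theorem exists_bound : ∃ B : ℝ, 0 ≤ B ∧ ∀ u, |φ u| ≤ B := by
  obtain ⟨B, hB⟩ := (hφ.continuous.norm).bddAbove_range_of_hasCompactSupport hφ.hasCompactSupport.norm
  refine ⟨max B 0, le_max_right _ _, fun u => ?_⟩
  have := hB ⟨u, rfl⟩
  simp only [Real.norm_eq_abs] at this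
  exact this.trans (le_max_left _ _)

/-- `φ'` is bounded. [folklore] -/
theorem exists_bound_deriv : ∃ B : ℝ, 0 ≤ B ∧ ∀ u, |deriv φ u| ≤ B := by
  have hc : Continuous (deriv φ) := hφ.contDiff.continuous_deriv (by exact_mod_cast le_top)
  have hs : HasCompactSupport (deriv φ) := hφ.hasCompactSupport.deriv
  obtain ⟨B, hB⟩ := hc.norm.bddAbove_range_of_hasCompactSupport hs.norm
  refine ⟨max B 0, le_max_right _ _, fun u => ?_⟩
  have := hB ⟨u, rfl⟩
  simp only [Real.norm_eq_abs] at this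
  exact this.trans (le_max_left _ _)

/-- `∫ u φ(u) du = 0` (`φ` is even). [folklore] -/
theorem integral_mul_self_eq_zero : ∫ u, u * φ u = 0 := by
  have h : ∫ u, u * φ u = ∫ u, (-u) * φ (-u) := (integral_neg_eq_self (fun u => u * φ u) volume).symm
  have h2 : ∫ u, (-u) * φ (-u) = -∫ u, u * φ u := by
    simp only [hφ.even, neg_mul, MeasureTheory.integral_neg]
  linarith

/-- `u ↦ φ(c - u)` has compact support. [folklore] -/
theorem hasCompactSupport_sub_left (c : ℝ) : HasCompactSupport fun u : ℝ => φ (c - u) := by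
  have h := hφ.hasCompactSupport.comp_homeomorph (Homeomorph.subLeft c)
  simpa [Function.comp_def] using h

/-- `u ↦ φ(c - u) u` is integrable. [folklore] -/
theorem integrable_sub_left_mul (c : ℝ) : Integrable fun u : ℝ => φ (c - u) * u :=
  ((hφ.continuous.comp (continuous_const.sub continuous_id)).mul continuous_id).integrable_of_hasCompactSupport
    (hφ.hasCompactSupport_sub_left c).mul_right

/-- `∫ φ(c - u) du = 1`. [folklore] -/
theorem integral_sub_left (c : ℝ) : ∫ u, φ (c - u) = 1 := by
  rw [integral_sub_left_eq_self φ volume c, hφ.integral_eq]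

/-- `∫ φ(c - u) u du = c` ("where we made the change of variables `u := log n - log t`";
uses `∫ φ = 1` and evenness). [cite: TaoTeravainen2021, §7 (7.1)] -/
theorem integral_sub_left_mul (c : ℝ) : ∫ u, φ (c - u) * u = c := by
  have h := integral_sub_left_eq_self (fun w => φ w * (c - w)) volume c
  simp only [sub_sub_cancel] at h
  rw [h]
  have h1 : ∫ w, φ w * (c - w) = ∫ w, (c * φ w - w * φ w) := by
    congr 1; funext w; ring
  have hi1 : Integrable fun w : ℝ => c * φ w := hφ.integrable.const_mul c
  have hi2 : Integrable fun w : ℝ => w * φ w :=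
    (continuous_id.mul hφ.continuous).integrable_of_hasCompactSupport
      hφ.hasCompactSupport.mul_left
  rw [h1, integral_sub hi1 hi2, MeasureTheory.integral_const_mul, hφ.integral_eq,
    hφ.integral_mul_self_eq_zero]
  ring

end IsBump

/-! ### `K_u(n) = χ ∗ Φ_{e^u}(n)` -/

variable {q : ℕ}

/-- `K_u(n) := ∑_{ab = n} χ(a) φ(log b - u)`, i.e. `χ ∗ Φ_t(n)` with `t = e^u`,
`Φ_t(b) = φ(log(b/t))`. [cite: TaoTeravainen2021, §7 ("define `Φ_t(n) := φ(log(n/t))`")] -/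
def hypK (χ : DirichletCharacter ℂ q) (φ : ℝ → ℝ) (u : ℝ) (n : ℕ) : ℝ :=
  ∑ p ∈ n.divisorsAntidiagonal, realChar χ p.1 * φ (Real.log p.2 - u)

/-- `K̃_u(n) := ∑_{ab = n} χ(a) φ'(log b - u)` (`= χ ∗ Φ̃_t(n)`, `Φ̃_t(n) = φ'(log(n/t))`).
[cite: TaoTeravainen2021, proof of Proposition 7.1 ("`Φ̃_t(n) := φ'(log(n/t))`")] -/
def hypKD (χ : DirichletCharacter ℂ q) (φ : ℝ → ℝ) (u : ℝ) (n : ℕ) : ℝ :=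
  ∑ p ∈ n.divisorsAntidiagonal, realChar χ p.1 * deriv φ (Real.log p.2 - u)

/-- `|∑_{ab=n} χ(a) g(b)| ≤ B τ(n)` when `|g| ≤ B`. [folklore] -/
theorem abs_sum_antidiagonal_realChar_mul_le (χ : DirichletCharacter ℂ q) {g : ℕ → ℝ} {B : ℝ}
    (hg : ∀ b, |g b| ≤ B) (n : ℕ) :
    |∑ p ∈ n.divisorsAntidiagonal, realChar χ p.1 * g p.2| ≤ B * n.divisors.card := by
  have hB : 0 ≤ B := (abs_nonneg _).trans (hg 1)
  calc |∑ p ∈ n.divisorsAntidiagonal, realChar χ p.1 * g p.2|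
      ≤ ∑ p ∈ n.divisorsAntidiagonal, |realChar χ p.1 * g p.2| := abs_sum_le_sum_abs _ _
    _ ≤ ∑ _p ∈ n.divisorsAntidiagonal, B := by
        refine sum_le_sum fun p _ => ?_
        rw [abs_mul]
        calc |realChar χ p.1| * |g p.2| ≤ 1 * B :=
              mul_le_mul (abs_realChar_le_one χ _) (hg _) (abs_nonneg _) zero_le_one
          _ = B := one_mul B
    _ = B * n.divisors.card := by
        rw [sum_const, nsmul_eq_mul, mul_comm, ← Nat.map_div_right_divisors, Finset.card_map]

/-- `|K_u(n)| ≤ ‖φ‖_∞ τ(n)`. [cite: TaoTeravainen2021, §7] -/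
theorem abs_hypK_le (χ : DirichletCharacter ℂ q) {φ : ℝ → ℝ} {B : ℝ} (hB : ∀ u, |φ u| ≤ B)
    (u : ℝ) (n : ℕ) : |hypK χ φ u n| ≤ B * n.divisors.card :=
  abs_sum_antidiagonal_realChar_mul_le χ (g := fun b => φ (Real.log b - u)) (fun _ => hB _) n

/-- `|K̃_u(n)| ≤ ‖φ'‖_∞ τ(n)`. [cite: TaoTeravainen2021, proof of Proposition 7.1] -/
theorem abs_hypKD_le (χ : DirichletCharacter ℂ q) {φ : ℝ → ℝ} {B : ℝ} (hB : ∀ u, |deriv φ u| ≤ B)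
    (u : ℝ) (n : ℕ) : |hypKD χ φ u n| ≤ B * n.divisors.card :=
  abs_sum_antidiagonal_realChar_mul_le χ (g := fun b => deriv φ (Real.log b - u)) (fun _ => hB _) n

/-- `K_u(n) = 0` unless `-1 ≤ u ≤ log n + 1` (for `n ≥ 1`; `K_u(0) = 0` always).
[cite: TaoTeravainen2021, §7 ("a smooth cutoff to the interval `[t/e, et]`")] -/
theorem hypK_eq_zero {φ : ℝ → ℝ} (hφ : IsBump φ) (χ : DirichletCharacter ℂ q) {u : ℝ} {n : ℕ}
    (hu : u < -1 ∨ Real.log n + 1 < u) : hypK χ φ u n = 0 := by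
  unfold hypK
  refine sum_eq_zero fun p hp => ?_
  rw [Nat.mem_divisorsAntidiagonal] at hp
  obtain ⟨hpn, hn⟩ := hp
  have hb1 : (1 : ℝ) ≤ p.2 := by
    have : 0 < p.2 := Nat.pos_of_ne_zero fun h => hn (by rw [← hpn, h, mul_zero])
    exact_mod_cast this
  have hbn : (p.2 : ℝ) ≤ n := by
    have : p.2 ≤ n := Nat.le_of_dvd (Nat.pos_of_ne_zero hn) ⟨p.1, by rw [← hpn, mul_comm]⟩
    exact_mod_cast this
  have hlog0 : 0 ≤ Real.log p.2 := Real.log_nonneg hb1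
  have hlogn : Real.log p.2 ≤ Real.log n := Real.log_le_log (by linarith) hbn
  rw [hφ.eq_zero _ ?_, mul_zero]
  rcases hu with hu | hu
  · rw [abs_of_pos (by linarith)]; linarith
  · rw [abs_of_neg (by linarith)]; linarith

/-- **(7.1)**: `χ∗log(n) = ∫ K_u(n) u du` ("`∫₀^∞ Φ_t(n) log t dt/t = log n` … We conclude that
`χ∗log(n) = ∫₀^∞ χ∗Φ_t(n) log t dt/t`"). [cite: TaoTeravainen2021, §7 (7.1)] -/
theorem charLog_eq_integral_hypK {φ : ℝ → ℝ} (hφ : IsBump φ) (χ : DirichletCharacter ℂ q) (n : ℕ) :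
    charLog χ n = ∫ u, hypK χ φ u n * u := by
  unfold charLog hypK
  simp_rw [sum_mul]
  rw [MeasureTheory.integral_finsetSum]
  · refine sum_congr rfl fun p _ => ?_
    have : (fun u : ℝ => realChar χ p.1 * φ (Real.log p.2 - u) * u) =
        fun u => realChar χ p.1 * (φ (Real.log p.2 - u) * u) := by
      funext u; ring
    rw [this, MeasureTheory.integral_const_mul, hφ.integral_sub_left_mul]
  · intro p _
    have : (fun u : ℝ => realChar χ p.1 * φ (Real.log p.2 - u) * u) =
        fun u => realChar χ p.1 * (φ (Real.log p.2 - u) * u) := by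
      funext u; ring
    rw [this]
    exact (hφ.integrable_sub_left_mul _).const_mul _

/-! ### The weight `ρ` and the flat/sharp parts -/

/-- The weight `ρ(u) = 1_{u ≤ X} (1 - ψ((X - u)/(2U₀)))`: the factor `ψ_{>(Dq_χ²)²}(x/t)` of (7.3)
in the variable `u = log t` (`X = log x`, `U₀ = log(Dq_χ²)`), set to `0` for `t > x`.
[cite: TaoTeravainen2021, §7 (7.3)] -/
def flatWeight (ψ : ℝ → ℝ) (X U₀ : ℝ) (u : ℝ) : ℝ :=
  if u ≤ X then 1 - ψ ((X - u) / (2 * U₀)) else 0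

/-- `ρ(u) = 0` for `u ≥ X - U₀` (there `ψ = 1`). [cite: TaoTeravainen2021, §7] -/
theorem flatWeight_eq_zero_of_le {ψ : ℝ → ℝ} (hψ : IsSmoothCutoff ψ) {X U₀ : ℝ} (hU₀ : 0 < U₀)
    {u : ℝ} (hu : X - U₀ ≤ u) : flatWeight ψ X U₀ u = 0 := by
  unfold flatWeight
  split_ifs with h
  · rw [hψ.eq_one _ ?_, sub_self]
    rw [abs_of_nonneg (div_nonneg (by linarith) (by linarith)), div_le_iff₀ (by linarith)]
    linarith
  · rfl

/-- `ρ(u) = 1` for `u ≤ X - 2U₀` (there `ψ = 0`). [cite: TaoTeravainen2021, §7] -/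
theorem flatWeight_eq_one_of_le {ψ : ℝ → ℝ} (hψ : IsSmoothCutoff ψ) {X U₀ : ℝ} (hU₀ : 0 < U₀)
    {u : ℝ} (hu : u ≤ X - 2 * U₀) : flatWeight ψ X U₀ u = 1 := by
  unfold flatWeight
  rw [if_pos (by linarith), hψ.eq_zero _ ?_, sub_zero]
  rw [abs_of_nonneg (div_nonneg (by linarith) (by linarith)), le_div_iff₀ (by linarith)]
  linarith

/-- `|ρ| ≤ 1 + sup|ψ|`. [folklore] -/
theorem abs_flatWeight_le {ψ : ℝ → ℝ} {Bψ : ℝ} (hB : ∀ u, |ψ u| ≤ Bψ) (X U₀ u : ℝ) :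
    |flatWeight ψ X U₀ u| ≤ 1 + Bψ := by
  unfold flatWeight
  split_ifs
  · calc |1 - ψ ((X - u) / (2 * U₀))| ≤ |(1 : ℝ)| + |ψ ((X - u) / (2 * U₀))| := abs_sub _ _
      _ ≤ 1 + Bψ := by rw [abs_one]; linarith [hB ((X - u) / (2 * U₀))]
  · rw [abs_zero]
    linarith [(abs_nonneg _).trans (hB 0)]

/-- On `u ≤ X` the weight is the smooth function `1 - ψ((X-u)/(2U₀))`. [folklore] -/
theorem flatWeight_eq_of_le {ψ : ℝ → ℝ} {X U₀ u : ℝ} (hu : u ≤ X) :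
    flatWeight ψ X U₀ u = 1 - ψ ((X - u) / (2 * U₀)) := if_pos hu

/-- `ρ` is continuous on `(-∞, X]` (indeed everywhere for `U₀ > 0`, which we do not need).
[folklore] -/
theorem continuousOn_flatWeight {ψ : ℝ → ℝ} (hψ : IsSmoothCutoff ψ) (X U₀ : ℝ) :
    ContinuousOn (flatWeight ψ X U₀) (Set.Iic X) := by
  have hc : Continuous fun u : ℝ => 1 - ψ ((X - u) / (2 * U₀)) :=
    continuous_const.sub (hψ.contDiff.continuous.comp ((continuous_const.sub continuous_id).div_const _))
  refine hc.continuousOn.congr fun u hu => ?_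
  exact flatWeight_eq_of_le hu

/-- **The flat part** `(χ∗log)♭(n) := ∫_{U₀}^{X-U₀} ρ(u) u K_u(n) du - (∫_{U₀}^{X} ρ(u) u du) K_{U₀}(n)`,
i.e. (7.3) `∫_{Dq²}^∞ ψ_{>(Dq²)²}(x/t) χ∗(Φ_t - Φ_{Dq²})(n) log t dt/t` in the variable `u = log t`
(the `Φ_t`-integrand vanishes for `u ≥ X - U₀`, where `ρ = 0`).
[cite: TaoTeravainen2021, §7 (7.3)] -/
def flatLog (χ : DirichletCharacter ℂ q) (φ ψ : ℝ → ℝ) (X U₀ : ℝ) (n : ℕ) : ℝ :=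
  (∫ u in U₀..(X - U₀), flatWeight ψ X U₀ u * u * hypK χ φ u n) -
    (∫ u in U₀..X, flatWeight ψ X U₀ u * u) * hypK χ φ U₀ n

/-- **The sharp part** `(χ∗log)♯ := χ∗log - (χ∗log)♭` ((7.2); the three-term expansion of the
source is derived in the §8 files). [cite: TaoTeravainen2021, §7 (7.2)] -/
def sharpLog (χ : DirichletCharacter ℂ q) (φ ψ : ℝ → ℝ) (X U₀ : ℝ) (n : ℕ) : ℝ :=
  charLog χ n - flatLog χ φ ψ X U₀ n

/-- `Λ♭_Siegel := (χ∗log)♭ ν`. [cite: TaoTeravainen2021, §7] -/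
def vonMangoldtSiegelFlat (χ : DirichletCharacter ℂ q) (φ ψ : ℝ → ℝ) (X U₀ R : ℝ) (n : ℕ) : ℝ :=
  flatLog χ φ ψ X U₀ n * selbergSieve ψ R n

/-- `Λ♯_Siegel := (χ∗log)♯ ν`. [cite: TaoTeravainen2021, §7] -/
def vonMangoldtSiegelSharp (χ : DirichletCharacter ℂ q) (φ ψ : ℝ → ℝ) (X U₀ R : ℝ) (n : ℕ) : ℝ :=
  sharpLog χ φ ψ X U₀ n * selbergSieve ψ R n

/-- `Λ_Siegel = Λ♯_Siegel + Λ♭_Siegel`. [cite: TaoTeravainen2021, §7] -/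
theorem vonMangoldtSiegel_eq_sharp_add_flat (χ : DirichletCharacter ℂ q) (φ ψ : ℝ → ℝ)
    (X U₀ R : ℝ) (n : ℕ) :
    vonMangoldtSiegel χ ψ R n =
      vonMangoldtSiegelSharp χ φ ψ X U₀ R n + vonMangoldtSiegelFlat χ φ ψ X U₀ R n := by
  unfold vonMangoldtSiegel vonMangoldtSiegelSharp vonMangoldtSiegelFlat sharpLog
  ring

/-! ### The integrated-by-parts form of `(χ∗log)♭` -/

/-- `u ↦ K_u(n)` is differentiable with derivative `-K̃_u(n)`. [cite: TaoTeravainen2021, proof of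
Proposition 7.1] -/
theorem hasDerivAt_hypK {φ : ℝ → ℝ} (hφ : IsBump φ) (χ : DirichletCharacter ℂ q) (n : ℕ) (u : ℝ) :
    HasDerivAt (fun v => hypK χ φ v n) (-hypKD χ φ u n) u := by
  unfold hypK hypKD
  rw [← sum_neg_distrib]
  refine HasDerivAt.fun_sum fun p _ => ?_
  have h1 : HasDerivAt φ (deriv φ (Real.log p.2 - u)) (Real.log p.2 - u) :=
    (hφ.contDiff.differentiable (by simp)).differentiableAt.hasDerivAt
  have hd : HasDerivAt (fun v : ℝ => φ (Real.log p.2 - v)) (-deriv φ (Real.log p.2 - u)) u :=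
    h1.comp_const_sub (Real.log p.2) u
  have := hd.const_mul (realChar χ p.1)
  rw [mul_neg] at this
  exact this

/-- `u ↦ K_u(n)` is continuous. [folklore] -/
theorem continuous_hypK {φ : ℝ → ℝ} (hφ : IsBump φ) (χ : DirichletCharacter ℂ q) (n : ℕ) :
    Continuous fun v => hypK χ φ v n := by
  unfold hypK
  exact continuous_finsetSum _ fun p _ =>
    continuous_const.mul (hφ.continuous.comp (continuous_const.sub continuous_id))

/-- `u ↦ K̃_u(n)` is continuous. [folklore] -/
theorem continuous_hypKD {φ : ℝ → ℝ} (hφ : IsBump φ) (χ : DirichletCharacter ℂ q) (n : ℕ) :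
    Continuous fun v => hypKD χ φ v n := by
  unfold hypKD
  have hc : Continuous (deriv φ) := hφ.contDiff.continuous_deriv (by exact_mod_cast le_top)
  exact continuous_finsetSum _ fun p _ =>
    continuous_const.mul (hc.comp (continuous_const.sub continuous_id))

/-- The kernel `P(v) := ∫_v^X ρ(u) u du` of the integrated-by-parts form. [cite: TaoTeravainen2021,
proof of Proposition 7.1] -/
def flatKernel (ψ : ℝ → ℝ) (X U₀ : ℝ) (v : ℝ) : ℝ :=
  ∫ u in v..X, flatWeight ψ X U₀ u * u

/-- `P` has derivative `-ρ(v) v` at every `v < X`. [folklore] -/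
theorem hasDerivAt_flatKernel {ψ : ℝ → ℝ} (hψ : IsSmoothCutoff ψ) (X U₀ : ℝ) {v : ℝ} (hv : v < X) :
    HasDerivAt (flatKernel ψ X U₀) (-(flatWeight ψ X U₀ v * v)) v := by
  unfold flatKernel
  -- `∫_v^X = -∫_X^v`, and the integrand is continuous on `(-∞, X]`
  have hcont : ContinuousOn (fun u => flatWeight ψ X U₀ u * u) (Set.Iic X) :=
    (continuousOn_flatWeight hψ X U₀).mul continuousOn_id
  have hsm : StronglyMeasurableAtFilter (fun u => flatWeight ψ X U₀ u * u) (𝓝 v) volume :=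
    (hcont.mono Set.Iio_subset_Iic_self).stronglyMeasurableAtFilter isOpen_Iio _ (Set.mem_Iio.mpr hv)
  have hcv : ContinuousAt (fun u => flatWeight ψ X U₀ u * u) v :=
    hcont.continuousAt (Iic_mem_nhds hv)
  have hint : ∀ a b : ℝ, a ≤ X → b ≤ X → IntervalIntegrable (fun u => flatWeight ψ X U₀ u * u) volume a b := by
    intro a b ha hb
    refine (hcont.mono ?_).intervalIntegrable
    intro u hu
    rw [Set.mem_Iic]
    rcases le_total a b with hab | hab
    · rw [Set.uIcc_of_le hab] at hu; exact hu.2.trans hb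
    · rw [Set.uIcc_of_ge hab] at hu; exact hu.2.trans ha
  have h := intervalIntegral.integral_hasDerivAt_right (hint X v le_rfl hv.le) hsm hcv
  -- `d/dv ∫_X^v = ρ(v) v`, so `d/dv ∫_v^X = -ρ(v) v`
  have h2 : HasDerivAt (fun w => -∫ u in X..w, flatWeight ψ X U₀ u * u)
      (-(flatWeight ψ X U₀ v * v)) v := h.neg
  refine h2.congr_of_eventuallyEq (Filter.Eventually.of_forall fun w => ?_)
  exact intervalIntegral.integral_symm X w

/-- `P(v) = 0` for `X - U₀ ≤ v ≤ X`. [cite: TaoTeravainen2021, §7] -/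
theorem flatKernel_eq_zero {ψ : ℝ → ℝ} (hψ : IsSmoothCutoff ψ) {X U₀ : ℝ} (hU₀ : 0 < U₀) {v : ℝ}
    (hv : X - U₀ ≤ v) : flatKernel ψ X U₀ v = 0 := by
  unfold flatKernel
  refine intervalIntegral.integral_zero_ae (Filter.Eventually.of_forall fun u hu => ?_)
  rw [flatWeight_eq_zero_of_le hψ hU₀, zero_mul]
  rcases le_total v X with h | h
  · rw [Set.uIoc_of_le h] at hu; exact hv.trans hu.1.le
  · rw [Set.uIoc_of_ge h] at hu; linarith [hu.1]

/-- `|P(v)| ≤ (1 + sup|ψ|) X (X - v)` for `0 ≤ v ≤ X`. [folklore] -/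
theorem abs_flatKernel_le {ψ : ℝ → ℝ} {Bψ : ℝ} (hB : ∀ u, |ψ u| ≤ Bψ) {X U₀ v : ℝ}
    (hv0 : 0 ≤ v) (hvX : v ≤ X) :
    |flatKernel ψ X U₀ v| ≤ (1 + Bψ) * X * (X - v) := by
  unfold flatKernel
  have hBψ0 : 0 ≤ 1 + Bψ := by linarith [(abs_nonneg _).trans (hB 0)]
  have h := intervalIntegral.norm_integral_le_of_norm_le_const (a := v) (b := X)
    (C := (1 + Bψ) * X) (f := fun u => flatWeight ψ X U₀ u * u) ?_
  · rw [Real.norm_eq_abs] at h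
    calc |∫ u in v..X, flatWeight ψ X U₀ u * u| ≤ (1 + Bψ) * X * |X - v| := h
      _ = (1 + Bψ) * X * (X - v) := by rw [abs_of_nonneg (by linarith)]
  · intro u hu
    rw [Set.uIoc_of_le hvX] at hu
    have hu0 : 0 ≤ u := by linarith [hu.1]
    rw [Real.norm_eq_abs, abs_mul, abs_of_nonneg hu0]
    exact mul_le_mul (abs_flatWeight_le hB X U₀ u) hu.2 hu0 hBψ0

/-- **The integrated-by-parts form**: for `0 < U₀`, `2U₀ ≤ X`,
`(χ∗log)♭(n) = -∫_{U₀}^{X-U₀} P(v) K̃_v(n) dv`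
("By the fundamental theorem of calculus … so by the triangle inequality it will suffice to
show … for all `Dq_χ² ≤ t ≤ x/(Dq_χ²)²`"). [cite: TaoTeravainen2021, proof of Proposition 7.1] -/
theorem flatLog_eq_neg_integral {φ ψ : ℝ → ℝ} (hφ : IsBump φ) (hψ : IsSmoothCutoff ψ)
    (χ : DirichletCharacter ℂ q) {X U₀ : ℝ} (hU₀ : 0 < U₀) (hX : 2 * U₀ ≤ X) (n : ℕ) :
    flatLog χ φ ψ X U₀ n = -∫ v in U₀..(X - U₀), flatKernel ψ X U₀ v * hypKD χ φ v n := by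
  -- integration by parts on `[U₀, X - U₀]` with `u = P`, `v = K_·(n)`
  have hXU : U₀ ≤ X - U₀ := by linarith
  have hIcc : Set.uIcc U₀ (X - U₀) = Set.Icc U₀ (X - U₀) := Set.uIcc_of_le hXU
  have hP : ∀ v ∈ Set.uIcc U₀ (X - U₀), HasDerivAt (flatKernel ψ X U₀)
      (-(flatWeight ψ X U₀ v * v)) v := by
    intro v hv
    rw [hIcc] at hv
    exact hasDerivAt_flatKernel hψ X U₀ (by linarith [hv.2])
  have hK : ∀ v ∈ Set.uIcc U₀ (X - U₀), HasDerivAt (fun w => hypK χ φ w n) (-hypKD χ φ v n) v :=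
    fun v _ => hasDerivAt_hypK hφ χ n v
  have hcontP' : ContinuousOn (fun v => -(flatWeight ψ X U₀ v * v)) (Set.Icc U₀ (X - U₀)) :=
    ((continuousOn_flatWeight hψ X U₀).mono (fun v hv => by
      rw [Set.mem_Iic]; linarith [hv.2])).mul continuousOn_id |>.neg
  have hP'int : IntervalIntegrable (fun v => -(flatWeight ψ X U₀ v * v)) volume U₀ (X - U₀) :=
    (hcontP'.mono (by rw [hIcc])).intervalIntegrable
  have hK'int : IntervalIntegrable (fun v => -hypKD χ φ v n) volume U₀ (X - U₀) :=
    (continuous_hypKD hφ χ n).neg.intervalIntegrable _ _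
  have hparts := intervalIntegral.integral_mul_deriv_eq_deriv_mul hP hK hP'int hK'int
  -- `∫ P (-K̃) = P(X-U₀) K - P(U₀) K_{U₀} - ∫ (-ρ v) K`
  rw [flatKernel_eq_zero hψ hU₀ le_rfl, zero_mul, zero_sub] at hparts
  have hlhs : ∫ v in U₀..(X - U₀), flatKernel ψ X U₀ v * -hypKD χ φ v n =
      -∫ v in U₀..(X - U₀), flatKernel ψ X U₀ v * hypKD χ φ v n := by
    rw [← intervalIntegral.integral_neg]
    congr 1; funext v; ring
  rw [hlhs] at hparts
  have hrhs : ∫ v in U₀..(X - U₀), -(flatWeight ψ X U₀ v * v) * hypK χ φ v n =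
      -∫ v in U₀..(X - U₀), flatWeight ψ X U₀ v * v * hypK χ φ v n := by
    rw [← intervalIntegral.integral_neg]
    congr 1; funext v; ring
  rw [hrhs] at hparts
  have hP0 : flatKernel ψ X U₀ U₀ = ∫ u in U₀..X, flatWeight ψ X U₀ u * u := rfl
  unfold flatLog
  rw [← hP0]
  linarith

/-! ### Crude bounds -/

/-- `0 ≤ X - 2U₀`-type bookkeeping: `|(χ∗log)♭(n)| ≤ (1 + sup|ψ|) X² · 2 ‖φ‖_∞ τ(n)` for
`0 ≤ U₀`, `2U₀ ≤ X` (crude; "From (2.16) we may bound …"). [cite: TaoTeravainen2021, proof of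
Proposition 7.1] -/
theorem abs_flatLog_le {φ ψ : ℝ → ℝ} {Bφ Bψ : ℝ} (hBφ : ∀ u, |φ u| ≤ Bφ)
    (hBψ : ∀ u, |ψ u| ≤ Bψ) (χ : DirichletCharacter ℂ q) {X U₀ : ℝ} (hU₀ : 0 ≤ U₀)
    (hX : 2 * U₀ ≤ X) (n : ℕ) :
    |flatLog χ φ ψ X U₀ n| ≤ 2 * ((1 + Bψ) * X ^ 2 * (Bφ * n.divisors.card)) := by
  have hBψ0 : 0 ≤ 1 + Bψ := by linarith [(abs_nonneg _).trans (hBψ 0)]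
  have hBφ0 : 0 ≤ Bφ := (abs_nonneg _).trans (hBφ 0)
  have hX0 : 0 ≤ X := by linarith
  have hτ : 0 ≤ Bφ * n.divisors.card := by positivity
  set T : ℝ := Bφ * n.divisors.card with hT
  -- the first integral
  have h1 : |∫ u in U₀..(X - U₀), flatWeight ψ X U₀ u * u * hypK χ φ u n| ≤
      (1 + Bψ) * X * T * |X - U₀ - U₀| := by
    have h := intervalIntegral.norm_integral_le_of_norm_le_const (a := U₀) (b := X - U₀)
      (C := (1 + Bψ) * X * T) (f := fun u => flatWeight ψ X U₀ u * u * hypK χ φ u n) ?_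
    · rwa [Real.norm_eq_abs] at h
    · intro u hu
      rw [Set.uIoc_of_le (by linarith)] at hu
      have hu0 : 0 ≤ u := by linarith [hu.1]
      rw [Real.norm_eq_abs, abs_mul, abs_mul, abs_of_nonneg hu0]
      have hw := abs_flatWeight_le hBψ X U₀ u
      have hk := abs_hypK_le χ hBφ u n
      have hu2 : u ≤ X := by linarith [hu.2]
      exact mul_le_mul (mul_le_mul hw hu2 hu0 hBψ0) hk (abs_nonneg _) (mul_nonneg hBψ0 hX0)
  -- the constant term
  set P0 : ℝ := (∫ u in U₀..X, flatWeight ψ X U₀ u * u) with hP0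
  have h2 : |P0| ≤ (1 + Bψ) * X * |X - U₀| := by
    have h := intervalIntegral.norm_integral_le_of_norm_le_const (a := U₀) (b := X)
      (C := (1 + Bψ) * X) (f := fun u => flatWeight ψ X U₀ u * u) ?_
    · rwa [Real.norm_eq_abs] at h
    · intro u hu
      rw [Set.uIoc_of_le (by linarith)] at hu
      have hu0 : 0 ≤ u := by linarith [hu.1]
      rw [Real.norm_eq_abs, abs_mul, abs_of_nonneg hu0]
      exact mul_le_mul (abs_flatWeight_le hBψ X U₀ u) hu.2 hu0 hBψ0
  have hA : |X - U₀ - U₀| ≤ X := by rw [abs_of_nonneg (by linarith)]; linarith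
  have hB : |X - U₀| ≤ X := by rw [abs_of_nonneg (by linarith)]; linarith
  have h3 : |P0 * hypK χ φ U₀ n| ≤ (1 + Bψ) * X * X * T := by
    rw [abs_mul]
    calc |P0| * |hypK χ φ U₀ n|
        ≤ ((1 + Bψ) * X * |X - U₀|) * T := mul_le_mul h2 (abs_hypK_le χ hBφ U₀ n) (abs_nonneg _)
            (by positivity)
      _ ≤ ((1 + Bψ) * X * X) * T := by gcongr
  have h4 : |∫ u in U₀..(X - U₀), flatWeight ψ X U₀ u * u * hypK χ φ u n| ≤
      (1 + Bψ) * X * T * X := h1.trans (by gcongr)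
  have h5 : |flatLog χ φ ψ X U₀ n| ≤
      |∫ u in U₀..(X - U₀), flatWeight ψ X U₀ u * u * hypK χ φ u n| + |P0 * hypK χ φ U₀ n| :=
    abs_sub _ _
  have h6 : (1 + Bψ) * X * T * X + (1 + Bψ) * X * X * T = 2 * ((1 + Bψ) * X ^ 2 * T) := by ring
  linarith

end TaoTeravainen

end Literature.Barriers.Parity
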